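import Summits.ABC.ABC.Theorems.TwistAmplificationSharpModerateLawCoreTransfer
import Summits.ABC.ABC.Theorems.TwistAmplificationSharpModerateLawCensusToDispersion

/-!
# Crux `TwistAmplification.SharpModerateLaw` (stmt-ABC-1975): every residue of the crux implies the canonical core
(`CuspLawD → CoreLaw`, `CoreLawIF → CoreLaw`, and the corollaries for each line)

Worker of lead `prover-line-stmt-ABC-1975-c4-0` (line `unit-plane-conic-two-torsion`, wave 2 of the open stub
`stub_cornerHall`, which stays OPEN), 2026-08-16.  Companion of `…CoreTransfer.lean` (`sharpModerateLaw_of_coreLaw :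
CoreLaw → SharpModerateLaw`): together they make the lead's Szpiro-robust `CoreLaw` (`…CoreDefs.lean`) THE canonical open
core of the crux — implied by the residue of every line, and implying the crux and the summit.

* §1 `nstar_le_mul_n5cusp` (`N* ≤ 36·N5cusp`: the extra factors of `N*` are `p` or `p²` at `p ∈ {2, 3}`),
  `cuspSetD_or_of_mem_cuspShell` (`cuspShell X Y ⊆ cuspSetD (36X) (2Y) ∪ cuspSetD (36X) Y`: level `2Y` when `M⁺ > Y`,
  level `Y` when `M⁺ = Y`; the converse direction of the landed `UnitPlane.cuspShell_or_of_mem_cuspSetD`),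
  `ncard_cuspShell_le_two_cuspSetD`;
* §2 **`coreLaw_of_cuspLawD : CuspLawD → CoreLaw`** (registered sub-goal): the dispersion line's transfer target gives the
  core.  The artefacts are absorbed as announced in `…CoreDefs.lean`: on `X^{κ₀−3} ≥ 5832 = 18³` the floor `X^{κ₀} ≤ Y`
  gives the aperture-8 cone condition `(36X)³ ≤ 8Y`, the cap `Y ≤ X^σ` gives `L ≤ 2X^σ ≤ (36X)^{max σ 7}`, and
  `(36X)^ε ≤ 36^ε(XY)^ε`, `L^{-1/6} ≤ Y^{-1/6}`; on `X^{κ₀−3} < 5832` one has `Y ≤ X^σ < 5832^{σ/(κ₀−3)}` and the shell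
  lies in a finite level box (`ncard_cuspShell_le_box`, `…CoreTransfer.lean`), whose size is absorbed in the constant
  (`one_le_coreBound`);
* §3 **`coreLaw_of_coreLawIF : CoreLawIF → CoreLaw`** (registered sub-goal): the landed injection `ncard_cuspShell_le`
  (`#cuspShell(X,Y) ≤ totalCount ⊤ X (186624Y)`, `…SyzygyTransfer.lean`) and `CoreLawIF` at `(κ₀, σ+2)`; the level factor
  `186624 = 432²` is absorbed by `X² ≥ 186624` for `X ≥ 432`, and `X < 432` is again a finite level box;
* §4 corollaries: `coreLaw_of_indexFormShellLawCone`, `coreLaw_of_spreadLawCone` (census lines),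
  `UnitPlane.coreLaw_of_unitPlaneResidue : LawWithConeE SpreadDeep6 1 → RingCensus6 → CornerHallLaw6 → CoreLaw` (this
  line's three open stubs), `CuspDispersion.coreLaw_of_regimeLawsTw : LawOn ResolvedRegimeTw → LawOn DeepRegimeTw →
  LawOn HallRegimeTw → CoreLaw` and `CuspDispersion.coreLaw_of_lawOn_thickTw_of_hall` (dispersion line).
-/

noncomputable section

-- the mandated summit namespace `Summit.ABC.ABC` (summit = problem) trips the duplicate-namespace linter
set_option linter.dupNamespace false

namespace Summit.ABC.ABC.Theorems.SharpModerateLaw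

open Real
open Summit.ABC.ABC.Theorems.SharpModerateLaw.CuspDispersion (Nstar cuspSetD CuspLawD LawOn cuspSetD_finite)
open scoped BigOperators

/-! ## 1. The cusp shell inside two dyadic cusp sets -/

/-- A product over a set of primes of a weight `1 ≤ f(p) ≤ p²` exceeds its sub-product over the primes `≥ 5` by at
most `f(2)·f(3) ≤ 36` (the primes `< 5` are `2` and `3`). -/
theorem prod_le_mul_prod_filter_five_le (S : Finset ℕ) (hS : ∀ p ∈ S, p.Prime) (f : ℕ → ℕ)
    (hf : ∀ p, 1 ≤ p → 1 ≤ f p ∧ f p ≤ p ^ 2) :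
    ∏ p ∈ S, f p ≤ 36 * ∏ p ∈ S with 5 ≤ p, f p := by
  have hsub : S.filter (fun p => ¬ 5 ≤ p) ⊆ ({2, 3} : Finset ℕ) := by
    intro p hp
    rw [Finset.mem_filter] at hp
    have hpP : p.Prime := hS p hp.1
    have h2 := hpP.two_le
    have h5 : p < 5 := not_le.mp hp.2
    interval_cases p
    · simp
    · simp
    · exact absurd hpP (by norm_num)
  have hsmall : ∏ p ∈ S with ¬ 5 ≤ p, f p ≤ 36 :=
    calc ∏ p ∈ S with ¬ 5 ≤ p, f p ≤ ∏ p ∈ ({2, 3} : Finset ℕ), f p := by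
          refine Finset.prod_le_prod_of_subset_of_one_le' hsub fun p hp _ => ?_
          have h1 : 1 ≤ p := by simp only [Finset.mem_insert, Finset.mem_singleton] at hp; omega
          exact (hf p h1).1
      _ ≤ ∏ p ∈ ({2, 3} : Finset ℕ), p ^ 2 := by
          refine Finset.prod_le_prod' fun p hp => ?_
          have h1 : 1 ≤ p := by simp only [Finset.mem_insert, Finset.mem_singleton] at hp; omega
          exact (hf p h1).2
      _ = 36 := by decide
  calc ∏ p ∈ S, f p = (∏ p ∈ S with 5 ≤ p, f p) * ∏ p ∈ S with ¬ 5 ≤ p, f p :=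
        (Finset.prod_filter_mul_prod_filter_not S _ f).symm
    _ ≤ (∏ p ∈ S with 5 ≤ p, f p) * 36 := Nat.mul_le_mul_left _ hsmall
    _ = 36 * ∏ p ∈ S with 5 ≤ p, f p := mul_comm _ _

/-- **`N* ≤ 36·N5cusp`**: the all-prime conductor proxy exceeds the proxy away from `6` exactly by the factors at
`p ∈ {2, 3}`, each `p` or `p²`, so by at most `2²·3² = 36`. -/
theorem nstar_le_mul_n5cusp (x : ℤ × ℤ) : Nstar x ≤ 36 * N5cusp x := by
  unfold Nstar N5cusp
  refine prod_le_mul_prod_filter_five_le _ (fun p hp => Nat.prime_of_mem_primeFactors hp) _ fun p hp => ?_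
  split_ifs
  · exact ⟨Nat.one_le_pow _ _ hp, le_rfl⟩
  · exact ⟨hp, by simpa using Nat.pow_le_pow_right hp (show 1 ≤ 2 by norm_num)⟩

/-- **Shells into dyadic cusp sets.** A pair of the cusp shell `cuspShell X Y` (`M⁺ ∈ [Y, 2Y)`, `N5cusp ≤ X`) lies in the
dyadic cusp set `cuspSetD (36X) (2Y)` (when `M⁺ > Y`) or `cuspSetD (36X) Y` (when `M⁺ = Y`): `M⁺ = Mcusp` as
`1728 ∣ c₄³ − c₆²` (`UnitPlane.cast_mcusp_eq_max`) and `N* ≤ 36·N5cusp ≤ 36X`. -/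
theorem cuspSetD_or_of_mem_cuspShell {X Y : ℝ} (hY : 0 < Y) {x : ℤ × ℤ} (hx : x ∈ cuspShell X Y) :
    x ∈ cuspSetD (36 * X) (2 * Y) ∨ x ∈ cuspSetD (36 * X) Y := by
  obtain ⟨h1, h2, h3, h1728, hTF, hlo, hhi, hN⟩ := hx
  have hM := UnitPlane.cast_mcusp_eq_max h1728
  have hN' : (Nstar x : ℝ) ≤ 36 * X := by
    calc (Nstar x : ℝ) ≤ ((36 * N5cusp x : ℕ) : ℝ) := by exact_mod_cast nstar_le_mul_n5cusp x
      _ = 36 * (N5cusp x : ℝ) := by push_cast; ring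
      _ ≤ 36 * X := by linarith
  have hc4 : (((|x.1| ^ 3 : ℤ)) : ℝ) ≤ (Mcusp x : ℝ) := by rw [hM]; exact le_max_left _ _
  have hΔ : (((|x.1 ^ 3 - x.2 ^ 2| : ℤ)) : ℝ) / 1728 ≤ (Mcusp x : ℝ) := by rw [hM]; exact le_max_right _ _
  rw [div_le_iff₀ (by norm_num : (0 : ℝ) < 1728)] at hΔ
  rcases hlo.lt_or_eq with hlt | heq
  · refine Or.inl ⟨h1, h2, h3, h1728, hTF, by linarith, by linarith, ?_, hN'⟩
    rw [← hM]; linarith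
  · refine Or.inr ⟨h1, h2, h3, h1728, hTF, by linarith, by linarith, ?_, hN'⟩
    rw [← hM, ← heq]; linarith

/-- Hence `#cuspShell(X, Y) ≤ #cuspSetD(36X, 2Y) + #cuspSetD(36X, Y)` for `Y ≥ 1` (the dyadic cusp sets are finite). -/
theorem ncard_cuspShell_le_two_cuspSetD {X Y : ℝ} (hY : 1 ≤ Y) :
    ((cuspShell X Y).ncard : ℝ) ≤ ((cuspSetD (36 * X) (2 * Y)).ncard : ℝ) + ((cuspSetD (36 * X) Y).ncard : ℝ) := by
  have hcover : cuspShell X Y ⊆ cuspSetD (36 * X) (2 * Y) ∪ cuspSetD (36 * X) Y := fun x hx =>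
    cuspSetD_or_of_mem_cuspShell (by linarith) hx
  have hfin : (cuspSetD (36 * X) (2 * Y) ∪ cuspSetD (36 * X) Y).Finite :=
    (cuspSetD_finite _ _ (by linarith)).union (cuspSetD_finite _ _ hY)
  exact_mod_cast (Set.ncard_le_ncard hcover hfin).trans (Set.ncard_union_le _ _)

/-- The right side of the core law dominates its constant: `1 ≤ (XY)^ε·(X·Y^{-1/6} + 1)` for `X, Y ≥ 1`, `ε ≥ 0`. -/
theorem one_le_coreBound {X Y ε : ℝ} (hX : 1 ≤ X) (hY : 1 ≤ Y) (hε : 0 ≤ ε) :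
    1 ≤ (X * Y) ^ ε * (X * Y ^ (-(1 / 6 : ℝ)) + 1) := by
  have hX0 : 0 ≤ X := by linarith
  have hY0 : 0 ≤ Y := by linarith
  have hE1 : 1 ≤ (X * Y) ^ ε := Real.one_le_rpow (by nlinarith) hε
  have hA0 : 0 ≤ X * Y ^ (-(1 / 6 : ℝ)) := mul_nonneg hX0 (Real.rpow_nonneg hY0 _)
  nlinarith

/-! ## 2. The dispersion core gives the canonical core -/

/-- **`coreLaw_of_cuspLawD`** (registered sub-goal of stmt-ABC-1975): the dispersion line's transfer target
`CuspLawD` (cone `X³ ≤ 8Y ≤ 8X^σ`, proxy `N*`, shells `(Y/2, Y]`, loss `X^ε`) implies the canonical core `CoreLaw`.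
On `X^{κ₀−3} ≥ 5832 = 18³` the region `X^{κ₀} ≤ Y` gives `(36X)³ ≤ 8Y`, and the law at `σ' = max σ 7` is applied at
`(36X, L)`, `L ∈ {2Y, Y}` (`ncard_cuspShell_le_two_cuspSetD`; `L ≤ 2X^σ ≤ (36X)^{σ'}`, `(36X)^ε ≤ 36^ε(XY)^ε`,
`L^{-1/6} ≤ Y^{-1/6}`); on `X^{κ₀−3} < 5832` the cap `Y ≤ X^σ < 5832^{σ/(κ₀−3)}` puts the shell in a finite level box.
Constant `K + 72·36^ε·max(C,0)`. -/
theorem coreLaw_of_cuspLawD : Summit.ABC.ABC.Theorems.SharpModerateLaw.CuspDispersion.CuspLawD → CoreLaw := by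
  intro hD κ₀ σ hκ₀ hκσ ε hε
  set σ' : ℝ := max σ 7 with hσ'
  have hσ'6 : 6 < σ' := lt_of_lt_of_le (by norm_num) (le_max_right σ 7)
  have hσσ' : σ ≤ σ' := le_max_left _ _
  obtain ⟨C, hC⟩ := hD σ' hσ'6 ε hε
  set C₀ : ℝ := max C 0 with hC₀
  have hC₀0 : 0 ≤ C₀ := le_max_right _ _
  -- the bounded regime `X^{κ₀−3} < 5832`: `Y ≤ X^σ < M₀`
  set M₀ : ℝ := (5832 : ℝ) ^ (σ / (κ₀ - 3)) with hM₀
  set K : ℝ := (Set.ncard {x : ℤ × ℤ | (1728 : ℤ) ∣ x.1 ^ 3 - x.2 ^ 2 ∧ (Mcusp x : ℝ) < 2 * M₀} : ℝ) with hK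
  have hK0 : 0 ≤ K := Nat.cast_nonneg _
  refine ⟨K + 2 * (36 * (36 : ℝ) ^ ε * C₀), fun X Y hX hY hlo hhi => ?_⟩
  have hX0 : 0 < X := by linarith
  have hY0 : 0 < Y := by linarith
  have hR1 := one_le_coreBound hX hY hε.le
  have hKC : 0 ≤ 2 * (36 * (36 : ℝ) ^ ε * C₀) := by positivity
  rcases lt_or_ge (X ^ (κ₀ - 3)) 5832 with hsmall | hlarge
  · -- bounded regime
    have hYM : Y < M₀ := by
      have hk3 : κ₀ - 3 ≠ 0 := by linarith
      have e1 : X ^ σ = (X ^ (κ₀ - 3)) ^ (σ / (κ₀ - 3)) := by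
        rw [← Real.rpow_mul hX0.le]; congr 1; field_simp
      have e2 : (X ^ (κ₀ - 3)) ^ (σ / (κ₀ - 3)) < (5832 : ℝ) ^ (σ / (κ₀ - 3)) :=
        Real.rpow_lt_rpow (by positivity) hsmall (div_pos (by linarith) (by linarith))
      calc Y ≤ X ^ σ := hhi
        _ < M₀ := by rw [e1]; exact e2
    calc ((cuspShell X Y).ncard : ℝ) ≤ K := ncard_cuspShell_le_box (by linarith)
      _ ≤ K * ((X * Y) ^ ε * (X * Y ^ (-(1 / 6 : ℝ)) + 1)) := le_mul_of_one_le_right hK0 hR1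
      _ ≤ (K + 2 * (36 * (36 : ℝ) ^ ε * C₀)) * ((X * Y) ^ ε * (X * Y ^ (-(1 / 6 : ℝ)) + 1)) := by
          gcongr; linarith
      _ = _ := by ring
  · -- law regime: `5832·X³ ≤ X^{κ₀} ≤ Y`
    have h5832 : 5832 * X ^ 3 ≤ Y := by
      have e1 : X ^ κ₀ = X ^ (κ₀ - 3) * X ^ ((3 : ℕ) : ℝ) := by
        rw [← Real.rpow_add hX0]; norm_num
      have e2 : X ^ ((3 : ℕ) : ℝ) = X ^ (3 : ℕ) := Real.rpow_natCast X 3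
      have hX3 : 0 ≤ X ^ (3 : ℕ) := by positivity
      calc 5832 * X ^ 3 ≤ X ^ (κ₀ - 3) * X ^ (3 : ℕ) := mul_le_mul_of_nonneg_right hlarge hX3
        _ = X ^ κ₀ := by rw [e1, e2]
        _ ≤ Y := hlo
    -- the law at one level `L ∈ [Y, 2Y]`
    have key : ∀ L : ℝ, Y ≤ L → L ≤ 2 * Y →
        ((cuspSetD (36 * X) L).ncard : ℝ) ≤
          36 * (36 : ℝ) ^ ε * C₀ * ((X * Y) ^ ε * (X * Y ^ (-(1 / 6 : ℝ)) + 1)) := by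
      intro L hL1 hL2
      have hX' : 1 ≤ 36 * X := by linarith
      have hL : 1 ≤ L := by linarith
      have hL0 : 0 < L := by linarith
      have hc1 : (36 * X) ^ 3 ≤ 8 * L := by nlinarith
      have hc2 : L ≤ (36 * X) ^ σ' := by
        have e1 : Y ≤ X ^ σ' := le_rpow_of_le_rpow_of_le hX hσσ' hhi
        have e2 : (36 * X) ^ σ' = (36 : ℝ) ^ σ' * X ^ σ' := Real.mul_rpow (by norm_num) hX0.le
        have e3 : (36 : ℝ) ≤ (36 : ℝ) ^ σ' := by
          calc (36 : ℝ) = 36 ^ (1 : ℝ) := (Real.rpow_one _).symm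
            _ ≤ 36 ^ σ' := Real.rpow_le_rpow_of_exponent_le (by norm_num) (by linarith)
        have e4 : 0 ≤ X ^ σ' := by positivity
        rw [e2]; nlinarith
      have hb := hC (36 * X) L hX' hL hc1 hc2
      have e1 : (36 * X) ^ ε ≤ (36 : ℝ) ^ ε * (X * Y) ^ ε := by
        rw [Real.mul_rpow (by norm_num) hX0.le]
        gcongr
        exact le_mul_of_one_le_right hX0.le hY
      have e2 : L ^ (-(1 / 6 : ℝ)) ≤ Y ^ (-(1 / 6 : ℝ)) := Real.rpow_le_rpow_of_nonpos hY0 hL1 (by norm_num)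
      have e3 : 36 * X * L ^ (-(1 / 6 : ℝ)) + 1 ≤ 36 * (X * Y ^ (-(1 / 6 : ℝ)) + 1) := by
        nlinarith [mul_le_mul_of_nonneg_left e2 hX0.le]
      have hnn : 0 ≤ (36 * X) ^ ε * (36 * X * L ^ (-(1 / 6 : ℝ)) + 1) := by positivity
      calc ((cuspSetD (36 * X) L).ncard : ℝ) ≤ C * (36 * X) ^ ε * (36 * X * L ^ (-(1 / 6 : ℝ)) + 1) := hb
        _ ≤ C₀ * ((36 * X) ^ ε * (36 * X * L ^ (-(1 / 6 : ℝ)) + 1)) := by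
            rw [mul_assoc]; exact mul_le_mul_of_nonneg_right (le_max_left _ _) hnn
        _ ≤ C₀ * ((36 : ℝ) ^ ε * (X * Y) ^ ε * (36 * (X * Y ^ (-(1 / 6 : ℝ)) + 1))) := by
            apply mul_le_mul_of_nonneg_left _ hC₀0
            exact mul_le_mul e1 e3 (by positivity) (by positivity)
        _ = 36 * (36 : ℝ) ^ ε * C₀ * ((X * Y) ^ ε * (X * Y ^ (-(1 / 6 : ℝ)) + 1)) := by ring
    have k1 := key (2 * Y) (by linarith) le_rfl
    have k2 := key Y le_rfl (by linarith)
    calc ((cuspShell X Y).ncard : ℝ)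
        ≤ ((cuspSetD (36 * X) (2 * Y)).ncard : ℝ) + ((cuspSetD (36 * X) Y).ncard : ℝ) :=
          ncard_cuspShell_le_two_cuspSetD hY
      _ ≤ 36 * (36 : ℝ) ^ ε * C₀ * ((X * Y) ^ ε * (X * Y ^ (-(1 / 6 : ℝ)) + 1)) +
            36 * (36 : ℝ) ^ ε * C₀ * ((X * Y) ^ ε * (X * Y ^ (-(1 / 6 : ℝ)) + 1)) := add_le_add k1 k2
      _ = 2 * (36 * (36 : ℝ) ^ ε * C₀) * ((X * Y) ^ ε * (X * Y ^ (-(1 / 6 : ℝ)) + 1)) := by ring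
      _ ≤ (K + 2 * (36 * (36 : ℝ) ^ ε * C₀)) * ((X * Y) ^ ε * (X * Y ^ (-(1 / 6 : ℝ)) + 1)) := by
          gcongr; linarith
      _ = _ := by ring

/-! ## 3. The index-form core gives the cusp core -/

/-- **`coreLaw_of_coreLawIF`** (registered sub-goal of stmt-ABC-1975): the index-form robust core implies the cusp
robust core.  The landed injection `ncard_cuspShell_le` (`#cuspShell(X, Y) ≤ totalCount ⊤ X (186624·Y)`,
`…SyzygyTransfer.lean`) and `CoreLawIF` at `(κ₀, σ + 2)`: for `X ≥ 432` (`432² = 186624`) the level `186624·Y` lies in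
`[X^{κ₀}, X^{σ+2}]`, and `(X·186624Y)^ε·(X(186624Y)^{-1/6} + 1) ≤ 186624^ε(XY)^ε(XY^{-1/6} + 1)`; for `X < 432` the cap
`Y ≤ X^σ < 432^σ` puts the shell in a finite level box.  Constant `K + max(C,0)·186624^ε`. -/
theorem coreLaw_of_coreLawIF : CoreLawIF → CoreLaw := by
  intro hIF κ₀ σ hκ₀ hκσ ε hε
  obtain ⟨C, hC⟩ := hIF κ₀ (σ + 2) hκ₀ (by linarith) ε hε
  set C₀ : ℝ := max C 0 with hC₀
  have hC₀0 : 0 ≤ C₀ := le_max_right _ _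
  set M₀ : ℝ := (432 : ℝ) ^ σ with hM₀
  set K : ℝ := (Set.ncard {x : ℤ × ℤ | (1728 : ℤ) ∣ x.1 ^ 3 - x.2 ^ 2 ∧ (Mcusp x : ℝ) < 2 * M₀} : ℝ) with hK
  have hK0 : 0 ≤ K := Nat.cast_nonneg _
  refine ⟨K + C₀ * (186624 : ℝ) ^ ε, fun X Y hX hY hlo hhi => ?_⟩
  have hX0 : 0 < X := by linarith
  have hY0 : 0 < Y := by linarith
  have hσ0 : 0 < σ := by linarith
  have hR1 := one_le_coreBound hX hY hε.le
  have hKC : 0 ≤ C₀ * (186624 : ℝ) ^ ε := by positivity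
  rcases lt_or_ge X 432 with hsmall | hlarge
  · -- bounded regime `X < 432`: `Y ≤ X^σ < 432^σ`
    have hYM : Y < M₀ := lt_of_le_of_lt hhi (Real.rpow_lt_rpow hX0.le hsmall hσ0)
    calc ((cuspShell X Y).ncard : ℝ) ≤ K := ncard_cuspShell_le_box (by linarith)
      _ ≤ K * ((X * Y) ^ ε * (X * Y ^ (-(1 / 6 : ℝ)) + 1)) := le_mul_of_one_le_right hK0 hR1
      _ ≤ (K + C₀ * (186624 : ℝ) ^ ε) * ((X * Y) ^ ε * (X * Y ^ (-(1 / 6 : ℝ)) + 1)) := by gcongr; linarith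
      _ = _ := by ring
  · -- law regime `X ≥ 432`: `186624·Y ≤ X²·X^σ = X^{σ+2}`
    have hup : 186624 * Y ≤ X ^ (σ + 2) := by
      have e1 : X ^ (σ + 2) = X ^ σ * X ^ ((2 : ℕ) : ℝ) := by rw [← Real.rpow_add hX0]; norm_num
      have e2 : X ^ ((2 : ℕ) : ℝ) = X ^ (2 : ℕ) := Real.rpow_natCast X 2
      have hX2 : (186624 : ℝ) ≤ X ^ (2 : ℕ) := by nlinarith
      have hXσ : 0 ≤ X ^ σ := by positivity
      rw [e1, e2]; nlinarith
    have h1 := hC X (186624 * Y) hX (by linarith) (by linarith) hup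
    have e1 : (X * (186624 * Y)) ^ ε = (186624 : ℝ) ^ ε * (X * Y) ^ ε := by
      rw [show X * (186624 * Y) = 186624 * (X * Y) by ring]; exact Real.mul_rpow (by norm_num) (by positivity)
    have e2 : (186624 * Y) ^ (-(1 / 6 : ℝ)) ≤ Y ^ (-(1 / 6 : ℝ)) :=
      Real.rpow_le_rpow_of_nonpos hY0 (by linarith) (by norm_num)
    have hE : 0 ≤ (X * (186624 * Y)) ^ ε := Real.rpow_nonneg (by positivity) ε
    have hA : 0 ≤ X * (186624 * Y) ^ (-(1 / 6 : ℝ)) + 1 := by positivity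
    have hA' : X * (186624 * Y) ^ (-(1 / 6 : ℝ)) + 1 ≤ X * Y ^ (-(1 / 6 : ℝ)) + 1 := by
      nlinarith [mul_le_mul_of_nonneg_left e2 hX0.le]
    calc ((cuspShell X Y).ncard : ℝ)
        ≤ (totalCount (fun _ _ _ _ => True) X (186624 * Y) : ℝ) := by exact_mod_cast ncard_cuspShell_le X Y
      _ ≤ C * (X * (186624 * Y)) ^ ε * (X * (186624 * Y) ^ (-(1 / 6 : ℝ)) + 1) := h1
      _ ≤ C₀ * (X * (186624 * Y)) ^ ε * (X * Y ^ (-(1 / 6 : ℝ)) + 1) :=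
          mul_le_mul (mul_le_mul_of_nonneg_right (le_max_left _ _) hE) hA' hA (mul_nonneg hC₀0 hE)
      _ = C₀ * (186624 : ℝ) ^ ε * ((X * Y) ^ ε * (X * Y ^ (-(1 / 6 : ℝ)) + 1)) := by rw [e1]; ring
      _ ≤ (K + C₀ * (186624 : ℝ) ^ ε) * ((X * Y) ^ ε * (X * Y ^ (-(1 / 6 : ℝ)) + 1)) := by gcongr; linarith
      _ = _ := by ring

/-! ## 4. Every residue of the crux gives the canonical core -/

/-- `IndexFormShellLawCone → CoreLaw` (the landed `coreLawIF_of_indexFormShellLawCone` and `coreLaw_of_coreLawIF`). -/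
theorem coreLaw_of_indexFormShellLawCone : IndexFormShellLawCone → CoreLaw :=
  fun h => coreLaw_of_coreLawIF (coreLawIF_of_indexFormShellLawCone h)

/-- `SpreadLawCone → CoreLaw`: the census lines' common open core gives the canonical core (the lead's
`indexFormShellLawCone_of_spreadLawCone`, `…UniformityDischarge.lean`). -/
theorem coreLaw_of_spreadLawCone : SpreadLawCone → CoreLaw :=
  fun h => coreLaw_of_indexFormShellLawCone (indexFormShellLawCone_of_spreadLawCone h)

namespace UnitPlane

/-- **The three open unit-plane stubs give the canonical core**: spread-deep law D1, ring census D2 and Hall corner E′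
(`= stub_cornerHall`) give `IndexFormShellLawCone` (`indexFormShellLawCone_of_residue`), hence `CoreLaw`. -/
theorem coreLaw_of_unitPlaneResidue : LawWithConeE SpreadDeep6 1 → RingCensus6 → CornerHallLaw6 → CoreLaw :=
  fun hD hR hH => coreLaw_of_indexFormShellLawCone (indexFormShellLawCone_of_residue hD hR hH)

end UnitPlane

namespace CuspDispersion

/-- **The three open dispersion stubs give the canonical core**: the twist-aware regime laws give `CuspLawD`
(`cuspLawD_of_regimesTw`), hence `CoreLaw`. -/
theorem coreLaw_of_regimeLawsTw : LawOn ResolvedRegimeTw → LawOn DeepRegimeTw → LawOn HallRegimeTw → CoreLaw :=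
  fun h3 h4 h5 => coreLaw_of_cuspLawD (cuspLawD_of_regimesTw h3 h4 h5)

/-- c2's unified thick core and the Hall regime law give the canonical core (`lawOn_resolvedRegimeTw_of_lawOn_thickTw`,
`lawOn_deepRegimeTw_of_lawOn_thickTw`). -/
theorem coreLaw_of_lawOn_thickTw_of_hall : LawOn ThickTw → LawOn HallRegimeTw → CoreLaw :=
  fun hT h5 => coreLaw_of_regimeLawsTw (lawOn_resolvedRegimeTw_of_lawOn_thickTw hT)
    (lawOn_deepRegimeTw_of_lawOn_thickTw hT) h5

end CuspDispersion

end Summit.ABC.ABC.Theorems.SharpModerateLaw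

end
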